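import Summits.AtomisticToContinuum.BoseEinsteinCondensation.Theorems.BECConjugateDominationHardCoreExtensionAlphaPairBookkeeping
import HarnessLib

/-!
# (α'₂) pair programme, bookkeeping for SOFT cores: a real penalisation level `V` (line `third-law-current-floor`,
# crux `HardCoreExtension`, stmt-AtomisticToContinuum-11786, lead c1, cycle 2)

The `ℝ≥0∞` wrappers of `AlphaPair.eta_bound` / `AlphaPair.final_bound` with the core penalisation `V·mK ≤ E` at a REAL level
`V` (for soft cores `V = C_big/δ²`, independent of the truncation height `m`, which only enters the optimality slack `1/(m+1)`).
[folklore]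
-/

noncomputable section

namespace Summit.AtomisticToContinuum.BoseEinsteinCondensation.Cruxes.HardCoreExtension.ThirdLawCurrentFloor

open scoped ENNReal NNReal

namespace AlphaPair

/-- `(mK + mO).toReal ≤ η₀` with a real penalisation level `V`. [folklore] -/
theorem eta_bound_ennreal_ofReal {K E mK mO mI Kl : ℝ≥0∞} {Cs ℓ a ε₁ η₀ V : ℝ}
    (hK : K ≠ ⊤) (hE : E ≤ K + 1) (hCs : 0 ≤ Cs) (hℓ : 0 < ℓ) (hℓa : ℓ ≤ a) (hV : 0 < V) (hε₁ : 0 < ε₁)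
    (hmK1 : mK ≤ 2) (hmO1 : mO ≤ 2)
    (hcore : ENNReal.ofReal V * mK ≤ E) (hinner : mI ≤ mK)
    (hshell : mO ≤ ENNReal.ofReal Cs * mI + ENNReal.ofReal (Cs * ℓ ^ 2) * Kl) (hKl : Kl ≤ ENNReal.ofReal ε₁)
    (hm1 : 2 * (1 + Cs) * (K.toReal + 1) ≤ η₀ * V) (hε₁a : ε₁ * (2 * (Cs + 1) * (a ^ 2 + 1)) ≤ η₀) :
    (mK + mO).toReal ≤ η₀ := by
  have h2 : (2 : ℝ≥0∞) ≠ ⊤ := ENNReal.ofNat_ne_top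
  have hmK : mK ≠ ⊤ := ne_top_of_le_ne_top h2 hmK1
  have hmO : mO ≠ ⊤ := ne_top_of_le_ne_top h2 hmO1
  have hmI : mI ≠ ⊤ := ne_top_of_le_ne_top hmK hinner
  have hKl' : Kl ≠ ⊤ := ne_top_of_le_ne_top ENNReal.ofReal_ne_top hKl
  have hK1 : K + 1 ≠ ⊤ := ENNReal.add_ne_top.2 ⟨hK, ENNReal.one_ne_top⟩
  have hshtop : ENNReal.ofReal Cs * mI + ENNReal.ofReal (Cs * ℓ ^ 2) * Kl ≠ ⊤ :=
    ENNReal.add_ne_top.2 ⟨ENNReal.mul_ne_top ENNReal.ofReal_ne_top hmI, ENNReal.mul_ne_top ENNReal.ofReal_ne_top hKl'⟩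
  have rcore : V * mK.toReal ≤ K.toReal + 1 := by
    have := ENNReal.toReal_mono hK1 (hcore.trans hE)
    rwa [ENNReal.toReal_mul, ENNReal.toReal_ofReal hV.le, ENNReal.toReal_add hK ENNReal.one_ne_top,
      ENNReal.toReal_one] at this
  have rinner : mI.toReal ≤ mK.toReal := ENNReal.toReal_mono hmK hinner
  have rshell : mO.toReal ≤ Cs * mI.toReal + Cs * ℓ ^ 2 * Kl.toReal := by
    have := ENNReal.toReal_mono hshtop hshell
    rwa [ENNReal.toReal_add (ENNReal.mul_ne_top ENNReal.ofReal_ne_top hmI)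
      (ENNReal.mul_ne_top ENNReal.ofReal_ne_top hKl'), ENNReal.toReal_mul, ENNReal.toReal_mul,
      ENNReal.toReal_ofReal hCs, ENNReal.toReal_ofReal (by positivity)] at this
  have rKl : Kl.toReal ≤ ε₁ := ENNReal.toReal_le_of_le_ofReal hε₁.le hKl
  rw [ENNReal.toReal_add hmK hmO]
  exact eta_bound hCs hℓ hℓa hV hε₁.le rcore rinner rshell rKl hm1 hε₁a

/-- The final `ε`-chain in `ℝ≥0∞` with a real penalisation level `V` (core) and a truncation height `m` (slack): `K ≤ Kₘ + ε`.
[folklore] -/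
theorem final_ennreal_ofReal {K Km q E mK mO mI Kl : ℝ≥0∞} {θ η η₀ Cs C ℓ ε ε₁ V : ℝ} {m : ℕ}
    (hK : K ≠ ⊤) (hKm : Km ≤ K) (hθ : 0 < θ) (hη : 0 ≤ η) (hηη₀ : η ≤ η₀) (hη₀ : η₀ ≤ 1 / 8)
    (hCs : 0 ≤ Cs) (hC : 0 ≤ C) (hℓ : 0 < ℓ) (hm : 0 < (m : ℝ)) (hV : 0 < V) (hε : 0 < ε) (hε₁ : 0 < ε₁)
    (hmK1 : mK ≤ 2) (hmO1 : mO ≤ 2)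
    (hGS : K ≤ ENNReal.ofReal (1 + 32 * η) * q)
    (hq : q ≤ ENNReal.ofReal (1 + θ) * E + ENNReal.ofReal ((1 + θ⁻¹) * (C / ℓ ^ 2)) * mO)
    (hE : E ≤ Km + ENNReal.ofReal (1 / ((m : ℝ) + 1))) (hcore : ENNReal.ofReal V * mK ≤ E) (hinner : mI ≤ mK)
    (hshell : mO ≤ ENNReal.ofReal Cs * mI + ENNReal.ofReal (Cs * ℓ ^ 2) * Kl) (hKl : Kl ≤ ENNReal.ofReal ε₁)
    (hθK : θ * (8 * (K.toReal + 1)) ≤ ε) (hη₀b : η₀ * (256 * (1 + θ) * (K.toReal + 1)) ≤ ε)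
    (hm2 : 40 * (1 + θ) ≤ ε * ((m : ℝ) + 1)) (hm3 : 80 * (1 + θ) * C * Cs * (K.toReal + 1) ≤ ε * θ * ℓ ^ 2 * V)
    (hε₁b : ε₁ * (40 * (C * Cs + 1) * (1 + θ)) ≤ ε * θ) :
    K ≤ Km + ENNReal.ofReal ε := by
  have h2 : (2 : ℝ≥0∞) ≠ ⊤ := ENNReal.ofNat_ne_top
  have hKmt : Km ≠ ⊤ := ne_top_of_le_ne_top hK hKm
  have hmK : mK ≠ ⊤ := ne_top_of_le_ne_top h2 hmK1
  have hmO : mO ≠ ⊤ := ne_top_of_le_ne_top h2 hmO1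
  have hmI : mI ≠ ⊤ := ne_top_of_le_ne_top hmK hinner
  have hKl' : Kl ≠ ⊤ := ne_top_of_le_ne_top ENNReal.ofReal_ne_top hKl
  have hEtop' : Km + ENNReal.ofReal (1 / ((m : ℝ) + 1)) ≠ ⊤ := ENNReal.add_ne_top.2 ⟨hKmt, ENNReal.ofReal_ne_top⟩
  have hEt : E ≠ ⊤ := ne_top_of_le_ne_top hEtop' hE
  have hA : 0 ≤ (1 + θ⁻¹) * (C / ℓ ^ 2) := by positivity
  have hqtop' : ENNReal.ofReal (1 + θ) * E + ENNReal.ofReal ((1 + θ⁻¹) * (C / ℓ ^ 2)) * mO ≠ ⊤ :=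
    ENNReal.add_ne_top.2 ⟨ENNReal.mul_ne_top ENNReal.ofReal_ne_top hEt, ENNReal.mul_ne_top ENNReal.ofReal_ne_top hmO⟩
  have hqt : q ≠ ⊤ := ne_top_of_le_ne_top hqtop' hq
  have hshtop : ENNReal.ofReal Cs * mI + ENNReal.ofReal (Cs * ℓ ^ 2) * Kl ≠ ⊤ :=
    ENNReal.add_ne_top.2 ⟨ENNReal.mul_ne_top ENNReal.ofReal_ne_top hmI, ENNReal.mul_ne_top ENNReal.ofReal_ne_top hKl'⟩
  have h32 : 0 ≤ 1 + 32 * η := by positivity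
  have rGS : K.toReal ≤ (1 + 32 * η) * q.toReal := by
    have := ENNReal.toReal_mono (ENNReal.mul_ne_top ENNReal.ofReal_ne_top hqt) hGS
    rwa [ENNReal.toReal_mul, ENNReal.toReal_ofReal h32] at this
  have rq : q.toReal ≤ (1 + θ) * E.toReal + (1 + θ⁻¹) * (C / ℓ ^ 2) * mO.toReal := by
    have := ENNReal.toReal_mono hqtop' hq
    rwa [ENNReal.toReal_add (ENNReal.mul_ne_top ENNReal.ofReal_ne_top hEt)
      (ENNReal.mul_ne_top ENNReal.ofReal_ne_top hmO), ENNReal.toReal_mul, ENNReal.toReal_mul,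
      ENNReal.toReal_ofReal (by positivity), ENNReal.toReal_ofReal hA] at this
  have rE : E.toReal ≤ Km.toReal + 1 / ((m : ℝ) + 1) := by
    have := ENNReal.toReal_mono hEtop' hE
    rwa [ENNReal.toReal_add hKmt ENNReal.ofReal_ne_top, ENNReal.toReal_ofReal (by positivity)] at this
  have rcore : V * mK.toReal ≤ K.toReal + 1 := by
    have h1 : ENNReal.ofReal V * mK ≤ K + 1 := by
      calc ENNReal.ofReal V * mK ≤ E := hcore
        _ ≤ Km + ENNReal.ofReal (1 / ((m : ℝ) + 1)) := hE
        _ ≤ K + 1 := add_le_add hKm (by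
            rw [← ENNReal.ofReal_one]; exact ENNReal.ofReal_le_ofReal (by
              rw [div_le_one (by positivity)]; linarith))
    have := ENNReal.toReal_mono (ENNReal.add_ne_top.2 ⟨hK, ENNReal.one_ne_top⟩) h1
    rwa [ENNReal.toReal_mul, ENNReal.toReal_ofReal hV.le, ENNReal.toReal_add hK ENNReal.one_ne_top,
      ENNReal.toReal_one] at this
  have rinner : mI.toReal ≤ mK.toReal := ENNReal.toReal_mono hmK hinner
  have rshell : mO.toReal ≤ Cs * mI.toReal + Cs * ℓ ^ 2 * Kl.toReal := by
    have := ENNReal.toReal_mono hshtop hshell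
    rwa [ENNReal.toReal_add (ENNReal.mul_ne_top ENNReal.ofReal_ne_top hmI)
      (ENNReal.mul_ne_top ENNReal.ofReal_ne_top hKl'), ENNReal.toReal_mul, ENNReal.toReal_mul,
      ENNReal.toReal_ofReal hCs, ENNReal.toReal_ofReal (by positivity)] at this
  have rKl : Kl.toReal ≤ ε₁ := ENNReal.toReal_le_of_le_ofReal hε₁.le hKl
  have rKm : Km.toReal ≤ K.toReal := ENNReal.toReal_mono hK hKm
  -- the real chain: structural step + term 1 (slack `m`) + term 2 (penalisation `V`)
  have h32' : 1 + 32 * η ≤ 5 := by linarith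
  have hAm : 0 ≤ (1 + θ⁻¹) * (C / ℓ ^ 2) * mO.toReal := mul_nonneg hA ENNReal.toReal_nonneg
  have hchain : K.toReal ≤ (1 + 32 * η) * ((1 + θ) * E.toReal) + 5 * ((1 + θ⁻¹) * (C / ℓ ^ 2) * mO.toReal) := by
    have h1 : (1 + 32 * η) * q.toReal ≤
        (1 + 32 * η) * ((1 + θ) * E.toReal + (1 + θ⁻¹) * (C / ℓ ^ 2) * mO.toReal) :=
      mul_le_mul_of_nonneg_left rq h32
    have h2' : (1 + 32 * η) * ((1 + θ⁻¹) * (C / ℓ ^ 2) * mO.toReal) ≤ 5 * ((1 + θ⁻¹) * (C / ℓ ^ 2) * mO.toReal) :=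
      mul_le_mul_of_nonneg_right h32' hAm
    have h3 : (1 + 32 * η) * ((1 + θ) * E.toReal + (1 + θ⁻¹) * (C / ℓ ^ 2) * mO.toReal) =
        (1 + 32 * η) * ((1 + θ) * E.toReal) + (1 + 32 * η) * ((1 + θ⁻¹) * (C / ℓ ^ 2) * mO.toReal) := by ring
    linarith
  have hT1 := term1_bound rKm ENNReal.toReal_nonneg hθ hη hηη₀ hη₀ hm rE hθK hη₀b hm2
  have hT2 := term2_bound hθ hCs hC hℓ hV hε₁.le rcore rinner rshell rKl hm3 hε₁b
  have key : K.toReal ≤ Km.toReal + ε := by linarith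
  calc K = ENNReal.ofReal K.toReal := (ENNReal.ofReal_toReal hK).symm
    _ ≤ ENNReal.ofReal (Km.toReal + ε) := ENNReal.ofReal_le_ofReal key
    _ = Km + ENNReal.ofReal ε := by rw [ENNReal.ofReal_add ENNReal.toReal_nonneg hε.le, ENNReal.ofReal_toReal hKmt]

end AlphaPair

/-- **Registered landing stub of this support file** (`stub_alphaPairBookkeepingSoft`, = `AlphaPair.final_ennreal_ofReal` with
all binders explicit). [folklore] -/
theorem stub_alphaPairBookkeepingSoft :
    ∀ (K Km q E mK mO mI Kl : ℝ≥0∞) (θ η η₀ Cs C ℓ ε ε₁ V : ℝ) (m : ℕ),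
      K ≠ ⊤ → Km ≤ K → 0 < θ → 0 ≤ η → η ≤ η₀ → η₀ ≤ 1 / 8 → 0 ≤ Cs → 0 ≤ C → 0 < ℓ → 0 < (m : ℝ) → 0 < V →
      0 < ε → 0 < ε₁ → mK ≤ 2 → mO ≤ 2 → K ≤ ENNReal.ofReal (1 + 32 * η) * q →
      q ≤ ENNReal.ofReal (1 + θ) * E + ENNReal.ofReal ((1 + θ⁻¹) * (C / ℓ ^ 2)) * mO →
      E ≤ Km + ENNReal.ofReal (1 / ((m : ℝ) + 1)) → ENNReal.ofReal V * mK ≤ E → mI ≤ mK →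
      mO ≤ ENNReal.ofReal Cs * mI + ENNReal.ofReal (Cs * ℓ ^ 2) * Kl → Kl ≤ ENNReal.ofReal ε₁ →
      θ * (8 * (K.toReal + 1)) ≤ ε → η₀ * (256 * (1 + θ) * (K.toReal + 1)) ≤ ε →
      40 * (1 + θ) ≤ ε * ((m : ℝ) + 1) → 80 * (1 + θ) * C * Cs * (K.toReal + 1) ≤ ε * θ * ℓ ^ 2 * V →
      ε₁ * (40 * (C * Cs + 1) * (1 + θ)) ≤ ε * θ →
      K ≤ Km + ENNReal.ofReal ε :=
  fun _ _ _ _ _ _ _ _ _ _ _ _ _ _ _ _ _ _ hK hKm hθ hη hηη₀ hη₀ hCs hC hℓ hm hV hε hε₁ hmK1 hmO1 hGS hq hE hcore hinner hshell hKl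
      hθK hη₀b hm2 hm3 hε₁b =>
    AlphaPair.final_ennreal_ofReal hK hKm hθ hη hηη₀ hη₀ hCs hC hℓ hm hV hε hε₁ hmK1 hmO1 hGS hq hE hcore hinner hshell hKl
      hθK hη₀b hm2 hm3 hε₁b

end Summit.AtomisticToContinuum.BoseEinsteinCondensation.Cruxes.HardCoreExtension.ThirdLawCurrentFloor

end
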